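import Summits.BirchSwinnertonDyer.Rank1Residual.Additive.X3BranchLayerTwoZeta27
import Summits.BirchSwinnertonDyer.Rank1Residual.Additive.X3BranchLayerCharTower
import Summits.BirchSwinnertonDyer.Rank1Residual.Additive.X3BranchLayerCharKernel
import Summits.BirchSwinnertonDyer.Rank1Residual.Additive.X3BranchKummerLayerTwistedZeta
import Summits.BirchSwinnertonDyer.Rank1Residual.Additive.X3BranchKummerLayerTwistedFixed
import Literature.NumberTheory.EllipticCurves.CyclotomicZpExtensionLayerProofs
import Literature.NumberTheory.EllipticCurves.RootNumberTableThreeLocalBridgeProofs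
import HarnessLib

/-!
# X3, the DEGENERATE rows OFF the sub-locus: STEP 3 of the independence argument for the layer
# T-side classes — on `Gal(ℚ̄/ℚ(ζ₉))` an additive character of the first layer group that dies on
# `G_{ℚ_∞}` is a multiple of the KUMMER CHARACTER OF `ζ₉`, so a radical it governs is
# `ζ₂₇^c · (element of ℚ(ζ₉))` (cell `bsd-eis`, seat `bsd-eis-x3` gen 8; assembly of gen 7's
# `LayerCharTower.*` (steps 1–2, the `ζ₂₇` lemma) and `KummerLayerTwisted.exists_aeval_of_forall_smul_eq`;
# MEMO-9 §2.4 (f); route K1 `AdditiveBranchIMC`, crux `GordTwoRankZeroOffCaseOne` — supports only)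

HONEST FRAMING (`run/shared/lean/pub/bsd-eis/README.md` §4): THEOREMS ONLY (no `def`, no named fact,
no `sorry`); nothing is booked; no label, tier or count of record moves.

## What

`κ` cyclotomic (`p = 3`), `L_n = κ.layerSubgroup n`, `ζ` a primitive `27`-th root of unity
(`ζ₉ = ζ³`, `ζ₃ = ζ⁹`), `ψ : Γ_ℚ → ℤ/3` locally constant, additive on `L₁`, zero on `ker κ`, and
`X ∈ ℚ̄` with `σX = ζ₃^{ψ σ}·X` for every `σ ∈ L₁` fixing `ζ₃` (a product of Kummer radicals whose
twisted characters combine to `ψ`). Then `X = ζ^c · G(ζ₉)` for some `c ∈ ℕ`, `G ∈ ℚ[X]`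
(`exists_eq_zeta27_pow_mul_aeval`). Ingredients:
* `exists_isCyclotomic_isTopGenerator_smul_eq` — WLOG the topological generator `γ` fixes `ζ₃`
  (else replace `(κ, γ)` by the unit twist `(κ·2⁻¹, γ²)`: same layers, same kernel);
* `exists_smul_zeta27_eq` — `σ ∈ L₁ ∩ Stab(ζ₃)` maps `ζ` to `ζ₃^e ζ` (it fixes `ζ₉`);
* `pow_three_smul_zeta27_ne` — `γ³` MOVES `ζ` (else `γ³ ∈ Gal(ℚ̄/ℚ(μ₂₇)) ≤ L₂`, but `κ γ³ = 3`);
* `exists_forall_smul_mul_inv_zeta27_pow_eq` — by steps 1–2, `ψ σ = j·ψ(γ³)` for `σ = h(γ³)^j`,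
  `h ∈ L₂`; on `Stab(ζ₉) ⊆ L₁ ∩ Stab(ζ₃)`, `h` fixes `ζ` (gen 7's `smul_zeta27_eq_of_mem_layerSubgroup_two`)
  and `σζ = ζ₃^{ej}ζ`, so `X·ζ^{-c}` with `c ≡ e·ψ(γ³)` is FIXED by `Stab(ζ₉)`;
  then Krull–Galois (`exists_aeval_of_forall_smul_eq`).
References: [Washington1997] §13.1; [SerreLocalFields1979] Ch. X §3; [NeukirchANT1999] Ch. IV §1.
-/

set_option autoImplicit false

noncomputable section

namespace Summit.BirchSwinnertonDyer.Rank1Residual.Additive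

namespace LayerCharTower

open Field Polynomial IntermediateField
open Literature.NumberTheory.GaloisRepresentations
open Literature.NumberTheory.EllipticCurves
open Summit.BirchSwinnertonDyer.Rank1Residual.Iwasawa.CyclotomicLayerOne

/-! ### §1 A topological generator fixing `ζ₃` -/

/-- **WLOG the topological generator fixes `ζ₃`.** For a cyclotomic `κ : ZpExtension ℚ 3` there is
a cyclotomic `κ'` with the SAME layer subgroups and kernel and a topological generator `γ` of `κ'`
with `γζ₃ = ζ₃`: if a generator `γ₀` of `κ` moves `ζ₃`, take `κ' = κ` twisted by the unit `2⁻¹`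
and `γ = γ₀²`. [cite: Washington1997, §13.1] -/
theorem exists_isCyclotomic_isTopGenerator_smul_eq {κ : ZpExtension ℚ 3} (hκ : κ.IsCyclotomic)
    {ω : AlgebraicClosure ℚ} (hω : IsPrimitiveRoot ω 3) :
    ∃ κ' : ZpExtension ℚ 3, κ'.IsCyclotomic ∧ (∀ n, κ'.layerSubgroup n = κ.layerSubgroup n) ∧
      κ'.kerSubgroup = κ.kerSubgroup ∧
      ∃ γ : absoluteGaloisGroup ℚ, κ'.IsTopGenerator γ ∧ γ • ω = ω := by
  obtain ⟨γ, hγ⟩ := κ.exists_isTopGenerator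
  rcases KummerLayerTwisted.smul_zeta_eq_or hω γ with h | h
  · exact ⟨κ, hκ, fun _ ↦ rfl, rfl, γ, hγ, h⟩
  · set u : ℤ_[3]ˣ := Rizzo.isUnit_two_padicInt_three.unit with hu
    have hu2 : (u : ℤ_[3]) = 2 := Rizzo.isUnit_two_padicInt_three.unit_spec
    refine ⟨κ.unitTwist u⁻¹, ?_, fun n ↦ κ.layerSubgroup_unitTwist _ n,
      κ.kerSubgroup_unitTwist _, γ ^ 2, ?_, ?_⟩
    · -- cyclotomic: same kernel
      change (κ.unitTwist u⁻¹).kerSubgroup = _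
      rw [ZpExtension.kerSubgroup_unitTwist]
      exact hκ
    · -- `γ²` is a topological generator of the twist
      change κ.unitTwist u⁻¹ (γ ^ 2) = Multiplicative.ofAdd 1
      rw [ZpExtension.unitTwist_apply, map_pow, show κ γ = Multiplicative.ofAdd 1 from hγ,
        ← ofAdd_nsmul, toAdd_ofAdd, nsmul_eq_mul, mul_one]
      congr 1
      rw [show ((2 : ℕ) : ℤ_[3]) = (u : ℤ_[3]) by rw [hu2]; norm_cast, Units.inv_mul]
    · rw [pow_two, mul_smul, h, smul_pow', h, ← pow_mul, show 2 * 2 = 3 + 1 from rfl, pow_succ,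
        hω.pow_eq_one, one_mul]

/-! ### §2 `ζ₂₇` under `L₁ ∩ Stab(ζ₃)` -/

/-- **`L₁ ∩ Stab(ζ₃)` fixes `ζ₉`**: `σ ∈ κ.layerSubgroup 1` (`κ` cyclotomic) fixes `θ = ζ₉ + ζ₉⁸`,
and if it fixes `ζ₃ = ζ₉³` it fixes `ζ₉`. [cite: Washington1997, §13.1] -/
theorem smul_zeta9_eq_self_of_mem_layerSubgroup_one {κ : ZpExtension ℚ 3} (hκ : κ.IsCyclotomic)
    {ζ : AlgebraicClosure ℚ} (hζ : IsPrimitiveRoot ζ 9) {σ : absoluteGaloisGroup ℚ}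
    (hσ : σ ∈ κ.layerSubgroup 1) (h3 : σ • ζ ^ 3 = ζ ^ 3) : σ • ζ = ζ := by
  have hmem := zeta_add_pow_mem_layer_one hκ ζ hζ.pow_eq_one
  rw [ZpExtension.layer, IntermediateField.mem_fixedField_iff] at hmem
  have hθ : σ • (ζ + ζ ^ 8) = ζ + ζ ^ 8 := hmem _ (Subgroup.mem_map.mpr ⟨σ, hσ, rfl⟩)
  exact KummerLayerTwisted.smul_zeta9_eq_self_of_smul_cube hζ hθ h3

/-- **`σ ∈ L₁ ∩ Stab(ζ₃)` maps `ζ₂₇` to `ζ₃^e·ζ₂₇`** (`σ` fixes `ζ₉ = ζ₂₇³`, so `σζ₂₇/ζ₂₇` is a cube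
root of unity). [cite: Washington1997, §13.1] -/
theorem exists_smul_zeta27_eq {κ : ZpExtension ℚ 3} (hκ : κ.IsCyclotomic)
    {ζ : AlgebraicClosure ℚ} (hζ : IsPrimitiveRoot ζ 27) {σ : absoluteGaloisGroup ℚ}
    (hσ : σ ∈ κ.layerSubgroup 1) (h9 : σ • ζ ^ 9 = ζ ^ 9) :
    ∃ e : ℕ, e < 3 ∧ σ • ζ = (ζ ^ 9) ^ e * ζ := by
  have hζ9 : IsPrimitiveRoot (ζ ^ 3) 9 := hζ.pow (by norm_num) (by norm_num)
  have hζ3 : IsPrimitiveRoot (ζ ^ 9) 3 := hζ.pow (by norm_num) (by norm_num)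
  have h3' : σ • (ζ ^ 3) ^ 3 = (ζ ^ 3) ^ 3 := by rw [← pow_mul]; exact h9
  have hfix3 : σ • ζ ^ 3 = ζ ^ 3 := smul_zeta9_eq_self_of_mem_layerSubgroup_one hκ hζ9 hσ h3'
  have hζ0 : ζ ≠ 0 := hζ.ne_zero (by norm_num)
  have hq : (σ • ζ * ζ⁻¹) ^ 3 = 1 := by
    rw [mul_pow, ← smul_pow', hfix3, inv_pow, mul_inv_cancel₀ (pow_ne_zero 3 hζ0)]
  obtain ⟨e, he, hζe⟩ := hζ3.eq_pow_of_pow_eq_one hq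
  exact ⟨e, he, by rw [hζe, inv_mul_cancel_right₀ hζ0]⟩

/-- Powers of an element fixing `y` fix `y`. [folklore] -/
theorem pow_smul_eq_self {σ : absoluteGaloisGroup ℚ} {y : AlgebraicClosure ℚ} (h : σ • y = y)
    (k : ℕ) : σ ^ k • y = y := by
  induction k with
  | zero => rw [pow_zero, one_smul]
  | succ k ih => rw [pow_succ, mul_smul, h, ih]

/-- **`γ³` MOVES `ζ₂₇`** for a topological generator `γ` of a cyclotomic `κ`: otherwise `γ³` fixes
all `27`-th roots of unity, hence lies in `κ.layerSubgroup 2`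
(`IsCyclotomic.rootsOfUnityFixer_le_layerSubgroup`), i.e. `9 ∣ κ(γ³) = 3`. [cite: Washington1997, §13.1] -/
theorem pow_three_smul_zeta27_ne {κ : ZpExtension ℚ 3} (hκ : κ.IsCyclotomic)
    {γ : absoluteGaloisGroup ℚ} (hγ : κ.IsTopGenerator γ)
    {ζ : AlgebraicClosure ℚ} (hζ : IsPrimitiveRoot ζ 27) : γ ^ 3 • ζ ≠ ζ := by
  intro h
  have hmem : γ ^ 3 ∈ rootsOfUnityFixer ℚ (3 ^ (2 + 1)) := by
    intro t ht
    have ht' : t ^ 27 = 1 := by norm_num at ht; exact ht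
    obtain ⟨k, -, rfl⟩ := hζ.eq_pow_of_pow_eq_one ht'
    rw [smul_pow', h]
  have h2 : γ ^ 3 ∈ κ.layerSubgroup 2 :=
    hκ.rootsOfUnityFixer_le_layerSubgroup (by norm_num) 2 hmem
  rw [ZpExtension.mem_layerSubgroup, map_pow, show κ γ = Multiplicative.ofAdd 1 from hγ,
    ← ofAdd_nsmul, toAdd_ofAdd, nsmul_eq_mul, mul_one] at h2
  have h3 : ((3 : ℤ_[3])) ^ 2 ∣ ((3 : ℤ) : ℤ_[3]) := by
    have : ((3 : ℤ) : ℤ_[3]) = ((3 : ℕ) : ℤ_[3]) := by norm_cast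
    rw [this]; exact_mod_cast h2
  have h4 : ((3 : ℕ) : ℤ_[3]) ^ 2 ∣ ((3 : ℤ) : ℤ_[3]) := by exact_mod_cast h3
  rw [PadicInt.pow_p_dvd_int_iff] at h4
  norm_num at h4

/-! ### §3 STEP 3: the radical is `ζ₂₇^c` times an element of `ℚ(ζ₉)` -/

/-- `ω^A = ω^B` for a primitive cube root of unity `ω` when `A ≡ B` in `ℤ/3`. [folklore] -/
theorem pow_eq_pow_of_natCast_eq {ω : AlgebraicClosure ℚ} (hω : IsPrimitiveRoot ω 3) {A B : ℕ}
    (h : (A : ZMod 3) = B) : ω ^ A = ω ^ B := by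
  have hmod : A % 3 = B % 3 := (ZMod.natCast_eq_natCast_iff A B 3).mp h
  rw [← Nat.mod_add_div A 3, ← Nat.mod_add_div B 3, pow_add, pow_add, pow_mul, pow_mul,
    hω.pow_eq_one, one_pow, one_pow, hmod]

/-- **STEP 3 (core).** `κ` cyclotomic, `ζ` a primitive `27`-th root of unity, `ψ : Γ_ℚ → ℤ/3` locally
constant, additive on `L₁ = κ.layerSubgroup 1` and zero on `ker κ`, `X ∈ ℚ̄` with
`σX = (ζ⁹)^{(ψ σ).val}·X` for all `σ ∈ L₁` fixing `ζ⁹`. Then for some `c ∈ ℕ` the element `X·(ζ^c)⁻¹`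
is FIXED by every `σ ∈ Γ_ℚ` fixing `ζ₉ = ζ³`. [cite: Washington1997, §13.1]
[cite: SerreLocalFields1979, Ch. X §3] -/
theorem exists_forall_smul_mul_inv_zeta27_pow_eq {κ : ZpExtension ℚ 3} (hκ : κ.IsCyclotomic)
    {ζ : AlgebraicClosure ℚ} (hζ : IsPrimitiveRoot ζ 27)
    {ψ : absoluteGaloisGroup ℚ → ZMod 3} (hlc : IsLocallyConstant ψ)
    (hadd : ∀ a ∈ κ.layerSubgroup 1, ∀ b ∈ κ.layerSubgroup 1, ψ (a * b) = ψ a + ψ b)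
    (hker : ∀ σ ∈ κ.kerSubgroup, ψ σ = 0)
    {X : AlgebraicClosure ℚ}
    (hX : ∀ σ ∈ κ.layerSubgroup 1, σ • ζ ^ 9 = ζ ^ 9 → σ • X = (ζ ^ 9) ^ (ψ σ).val * X) :
    ∃ c : ℕ, ∀ σ : absoluteGaloisGroup ℚ, σ • ζ ^ 3 = ζ ^ 3 →
      σ • (X * (ζ ^ c)⁻¹) = X * (ζ ^ c)⁻¹ := by
  have hζ3 : IsPrimitiveRoot (ζ ^ 9) 3 := hζ.pow (by norm_num) (by norm_num)
  have hζ9 : IsPrimitiveRoot (ζ ^ 3) 9 := hζ.pow (by norm_num) (by norm_num)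
  have hζ0 : ζ ≠ 0 := hζ.ne_zero (by norm_num)
  -- WLOG the generator fixes `ζ₃ = ζ⁹`
  obtain ⟨κ', hκ', hlay, hker', γ, hγ, hγN⟩ := exists_isCyclotomic_isTopGenerator_smul_eq hκ hζ3
  have hadd' : ∀ a ∈ κ'.layerSubgroup 1, ∀ b ∈ κ'.layerSubgroup 1, ψ (a * b) = ψ a + ψ b := by
    rw [hlay]; exact hadd
  have hkerψ : ∀ σ ∈ κ'.kerSubgroup, ψ σ = 0 := by rw [hker']; exact hker
  have hX' : ∀ σ ∈ κ'.layerSubgroup 1, σ • ζ ^ 9 = ζ ^ 9 → σ • X = (ζ ^ 9) ^ (ψ σ).val * X := by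
    rw [hlay]; exact hX
  -- STEP 1: `ψ` vanishes on some `L_m`, hence on `L_{m+2}`
  obtain ⟨m, hm⟩ := exists_layerSubgroup_subset_of_isLocallyConstant κ' hlc hkerψ
  have hvan : ∀ σ ∈ κ'.layerSubgroup (m + 2), ψ σ = 0 := fun σ hσ ↦
    hm σ (κ'.layerSubgroup_antitone (by omega) hσ)
  -- `γ³ ∈ L₁` fixes `ζ⁹`, maps `ζ ↦ (ζ⁹)^e ζ` with `e ≠ 0`
  have hγ3L1 : γ ^ 3 ∈ κ'.layerSubgroup 1 := by
    have h := pow_mem_layerSubgroup κ' hγ 1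
    rwa [pow_one] at h
  have hγ3N : γ ^ 3 • ζ ^ 9 = ζ ^ 9 := pow_smul_eq_self hγN 3
  obtain ⟨e, -, hγe⟩ := exists_smul_zeta27_eq hκ' hζ hγ3L1 hγ3N
  have he0 : (e : ZMod 3) ≠ 0 := by
    intro he
    have he' : e % 3 = 0 := by
      have := (ZMod.natCast_eq_zero_iff e 3).mp he
      omega
    apply pow_three_smul_zeta27_ne hκ' hγ hζ
    rw [hγe, ← Nat.div_add_mod e 3, he', add_zero, pow_mul, hζ3.pow_eq_one, one_pow, one_mul]
  have hee : (e : ZMod 3) * e = 1 := by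
    have hcases : ∀ z : ZMod 3, z ≠ 0 → z * z = 1 := by decide
    exact hcases _ he0
  -- powers of `γ³` on `ζ⁹` and on `ζ`
  have hγ3k9 : ∀ k : ℕ, (γ ^ 3) ^ k • ζ ^ 9 = ζ ^ 9 := pow_smul_eq_self hγ3N
  have hγ3kζ : ∀ k : ℕ, (γ ^ 3) ^ k • ζ = (ζ ^ 9) ^ (e * k) * ζ := by
    intro k
    induction k with
    | zero => rw [pow_zero, one_smul, mul_zero, pow_zero, one_mul]
    | succ k ih =>
      rw [pow_succ, mul_smul, hγe, smul_mul', smul_pow', hγ3k9 k, ih, ← mul_assoc, ← pow_add]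
      congr 2
      ring
  set a : ZMod 3 := ψ (γ ^ 3) with ha
  refine ⟨e * a.val, fun σ hσ3 ↦ ?_⟩
  -- `σ` fixes `ζ⁹` and lies in `L₁`
  have hσ9 : σ • ζ ^ 9 = ζ ^ 9 := by
    rw [show ζ ^ 9 = (ζ ^ 3) ^ 3 by ring, smul_pow', hσ3]
  have hσL1 : σ ∈ κ'.layerSubgroup 1 := by
    refine hκ'.rootsOfUnityFixer_le_layerSubgroup (by norm_num) 1 ?_
    intro t ht
    have ht' : t ^ 9 = 1 := by norm_num at ht; exact ht
    obtain ⟨k, -, rfl⟩ := hζ9.eq_pow_of_pow_eq_one ht'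
    rw [smul_pow', hσ3]
  -- STEP 2: `σ = h (γ³)^j`, `h ∈ L₂`, `ψ σ = j·a`
  obtain ⟨h, j, hh2, hσeq, hψσ⟩ := exists_addCharOn_eq_mul κ' hadd' hγ m hvan hσL1
  -- `h` fixes `ζ⁹`, hence `ζ`
  have hh9 : h • ζ ^ 9 = ζ ^ 9 := by
    have hh : h = σ * ((γ ^ 3) ^ j)⁻¹ := by rw [hσeq, mul_inv_cancel_right]
    rw [hh, mul_smul, inv_smul_eq_iff.mpr (hγ3k9 j).symm, hσ9]
  have hhζ : h • ζ = ζ := smul_zeta27_eq_of_mem_layerSubgroup_two hκ' hh2 hζ hh9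
  -- `σζ = (ζ⁹)^{ej} ζ`
  have hσζ : σ • ζ = (ζ ^ 9) ^ (e * j) * ζ := by
    rw [hσeq, mul_smul, hγ3kζ j, smul_mul', smul_pow', smul_pow', hhζ]
  -- `σX = (ζ⁹)^{(j a).val} X`
  have hXσ := hX' σ hσL1 hσ9
  rw [hψσ] at hXσ
  -- exponent bookkeeping modulo `3`
  have hexp : ((((j : ZMod 3) * a).val : ℕ) : ZMod 3) = ((e * j * (e * a.val) : ℕ) : ZMod 3) := by
    rw [ZMod.natCast_zmod_val]
    push_cast
    rw [ZMod.natCast_zmod_val]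
    linear_combination (-(j : ZMod 3) * a) * hee
  have hpow : (ζ ^ 9) ^ (((j : ZMod 3) * a).val) = (ζ ^ 9) ^ (e * j * (e * a.val)) :=
    pow_eq_pow_of_natCast_eq hζ3 hexp
  rw [smul_mul', smul_inv'', smul_pow', hσζ, hXσ, hpow, mul_pow, ← pow_mul]
  have hne : (ζ ^ 9) ^ (e * j * (e * a.val)) ≠ 0 := pow_ne_zero _ (pow_ne_zero _ hζ0)
  have hne' : ζ ^ (e * a.val) ≠ 0 := pow_ne_zero _ hζ0
  field_simp
  ring

/-- **STEP 3.** Under the hypotheses of `exists_forall_smul_mul_inv_zeta27_pow_eq`: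
`X = ζ^c · G(ζ³)` for some `c ∈ ℕ` and `G ∈ ℚ[X]` (Krull–Galois at `ℚ(ζ₉)`, gen 7's
`KummerLayerTwisted.exists_aeval_of_forall_smul_eq`). [cite: Washington1997, §13.1]
[cite: NeukirchANT1999, Ch. IV §1] -/
theorem exists_eq_zeta27_pow_mul_aeval {κ : ZpExtension ℚ 3} (hκ : κ.IsCyclotomic)
    {ζ : AlgebraicClosure ℚ} (hζ : IsPrimitiveRoot ζ 27)
    {ψ : absoluteGaloisGroup ℚ → ZMod 3} (hlc : IsLocallyConstant ψ)
    (hadd : ∀ a ∈ κ.layerSubgroup 1, ∀ b ∈ κ.layerSubgroup 1, ψ (a * b) = ψ a + ψ b)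
    (hker : ∀ σ ∈ κ.kerSubgroup, ψ σ = 0)
    {X : AlgebraicClosure ℚ}
    (hX : ∀ σ ∈ κ.layerSubgroup 1, σ • ζ ^ 9 = ζ ^ 9 → σ • X = (ζ ^ 9) ^ (ψ σ).val * X) :
    ∃ (c : ℕ) (G : ℚ[X]), X = ζ ^ c * aeval (ζ ^ 3) G := by
  obtain ⟨c, hc⟩ := exists_forall_smul_mul_inv_zeta27_pow_eq hκ hζ hlc hadd hker hX
  have hint : IsIntegral ℚ (ζ ^ 3) :=
    ((hζ.pow (by norm_num) (by norm_num) : IsPrimitiveRoot (ζ ^ 3) 9).isIntegral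
      (by norm_num)).tower_top
  obtain ⟨G, hG⟩ := KummerLayerTwisted.exists_aeval_of_forall_smul_eq hint hc
  have hζ0 : ζ ≠ 0 := hζ.ne_zero (by norm_num)
  refine ⟨c, G, ?_⟩
  rw [← hG, mul_comm, inv_mul_cancel_right₀ (pow_ne_zero c hζ0)]

end LayerCharTower

end Summit.BirchSwinnertonDyer.Rank1Residual.Additive

end
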